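import Summits.BirchSwinnertonDyer.BirchSwinnertonDyer.Theorems.PrintCf2SplitBadTwoLineNoSplitPrimes
import Literature.NumberTheory.GaloisRepresentations.LocalOneUnitsNumberFieldProofs
import Literature.NumberTheory.GaloisRepresentations.IdelicCharacterProofs
import HarnessLib

/-!
# Crux `PrintCf2.SplitBadTwoRankOneOfFacts` (stmt-BirchSwinnertonDyer-20368), road α v10.3 — the class-field-theoretic input (C3), part 1:
# **UNIQUENESS OF THE `ℤ_p`-LINE UNRAMIFIED OUTSIDE A SPLIT PRIME OF AN IMAGINARY QUADRATIC FIELD, PROVED**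

Cell `bsd-print-cf2`, width seat `bsd-line-cf2-p1-w6` g3 (prover-bsd-line-cf2-p1-w6-g3-0). `--supports stmt-BirchSwinnertonDyer-20368`
(helper, Theses-free). HONEST FRAMING: nothing here closes the crux or a registered stub; BSD is not proved by any of this; no summit
statement is proved by this seat. No definition, no named fact, no `sorry`.

WHY. The exact dyadic local kernel `LK_{v̄}` of the control of `𝔖_{v̄}(K*_∞, W*)` — residual (R-DYADIC) of the S3c assembly
(`…RestrictedControlOfResidualsNoC1`, LEAD g12 cut 5) — is, after -w2 g9's files 9/11/12/13, a theorem from ONE class-field-theoretic input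
(C3-loc) «`σ ∈ D_{v̄}` lies in `ker κ'` iff it acts as `±1` on `W*`», the local shadow of (C3) «`ker κ' = ψ_{W*}⁻¹(±1)`» (B15 memo §1):
the `ℤ₂`-line cut out by the character of `W*` modulo `±1` is unramified outside `v̄`, hence IS `K*_∞` — by the UNIQUENESS of the
`ℤ_p`-line unramified outside a split prime. That uniqueness is the second conjunct of the tree's NAMED FACT (R2)
`ZpExtension.existsUnique_isUnramifiedOutside_of_split` (Agboola 2007 §1 / de Shalit II.4.17 / Coates 1983 §2 / Müller 2020 §1: «by class
field theory there exists exactly one `ℤ₂`-extension `K_∞/K` unramified outside `𝔭`»), so far UNPROVED in the tree. THIS FILE PROVES IT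
(the uniqueness conjunct, verbatim shape `κ'.kerSubgroup = κ.kerSubgroup`), idelically, from the tree's PROVED global class field theory —
the same currency as -w3 g8's (C1) `LineDecomposition.decomp_not_le_kerSubgroup_of_isUnramifiedOutside` (whose §2 is reused by name).

WHAT. `K` imaginary quadratic, `v ≠ v̄` two places above `p` (ANY prime `p`), `κ, κ'` two `ℤ_p`-extensions of `K` unramified outside `v̄`:
**`kerSubgroup_eq_of_isUnramifiedOutside : κ'.kerSubgroup = κ.kerSubgroup`** (`K_∞ = K'_∞`); and the relation behind it,
**`exists_mul_eq_mul_of_isUnramifiedOutside : ∃ c c' ≠ 0, ∀ γ, c' · κ γ = c · κ' γ`** (`κ' = (c'/c) κ`, a unit twist).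
PROOF (Washington §13.1, proof of Thm. 13.4, run for ONE place). `Λ, Λ'` the idelic characters of `κ, κ'` (`ZpExtension.exists_idelicCharacter`).
(§1) Both kill `Kˣ` and the local units `𝒪_uˣ` at every `u ≠ v̄` (away from `p`: Washington 13.2, tree `idelicCharacter_localUnits_integer`; at
`u = v`: `I_v ≤ ker κ` and the local symbol, -w3 g8 `idelicCharacter_unitsMap_eq_one_of_inertia_le`). (§2) `Hom_cont(𝒪_{v̄}ˣ, ℤ_p)` has
`ℤ_p`-rank `n_{v̄} = 1`: the tree's `OneUnits.exists_continuousMonoidHom_adicCompletionIntegers_rank` gives `n_u` characters `φ_i` at each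
`u ∣ p` with `p^N ψ = Σ c_i φ_i` for every `ψ`, `p^{n_u} = #(𝒪_u/p)`, and `Σ_{u∣p} n_u = [K:ℚ] = 2` (`OneUnits.sum_eq_finrank`); `n_u ≥ 1` at
`u ∣ p` (`p` is a non-unit of `𝒪_u`), so `n_v, n_{v̄} ≥ 1` force `n_{v̄} = 1`. Hence `p^N Λ = c φ`, `p^N Λ' = c' φ` on `𝒪_{v̄}ˣ`, with
`c, c' ≠ 0` (else `Λ` kills ALL local units above `p`, against `exists_idelicCharacter_localUnits_ne_one`). (§3) The character
`G = c' Λ − c Λ'` kills `Kˣ` and every `𝒪_uˣ`, `u ∣ p`, so `G = 1` (`IdelicCharacter.eq_one_of_forall_localUnits`: class number + unit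
ideles die in `ℤ_p`); by the surjectivity of `[·, K]` (`exists_ideleArtinMap_eq`) `c' κ = c κ'` on `Γ_K`, and `ℤ_p` is a domain.
presearch: Washington 1997 §13.1 Thm. 13.4 (proof) / Prop. 13.2, Lang 1990 Ch. 5 §5 Thm. 5.1–5.2, de Shalit 1987 II.4.17, Müller arXiv:2002.05647
§1 — held/cited in the tree's R2 docstring; the tree's `IwasawaZpRankGlobalReciprocityProofs` (rank ≤ [K:ℚ]) is the template; no fact filed.
beyond-print theorem: no (standard CFT).

References: [Washington1997] §13.1 (Prop. 13.2, Thm. 13.4); [Lang1990] Ch. 5 §5; [deShalit1987] II §4.17; [Agboola2007] §1;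
[NeukirchANT1999] II (5.7), VI (5.6); [CasselsFrohlichANT1967] VII §4.2.
-/

noncomputable section

open Field NumberField IsDedekindDomain

set_option linter.dupNamespace false
set_option autoImplicit false

namespace Summit.BirchSwinnertonDyer.BirchSwinnertonDyer.Theorems.PrintCf2.LineDecomposition

open Literature.NumberTheory.GaloisRepresentations Literature.NumberTheory.NumberFields
open Literature.NumberTheory.EllipticCurves Literature.NumberTheory.EllipticCurves.ZpExtension

variable {K : Type} [Field K] [NumberField K] {p : ℕ} [Fact p.Prime]

/-! ## §1. The idelic character of a line unramified outside `v̄` kills the local units at every `u ≠ v̄` -/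

/-- **`Λ(⟨𝒪_uˣ⟩) = 1` at every finite place `u ≠ v̄`** for the idelic character `Λ` of a `ℤ_p`-extension `κ` unramified outside `v̄`:
away from `p` by Washington's Prop. 13.2 (tree `idelicCharacter_localUnits_integer`), above `p` by `I_u ≤ ker κ` and the local symbol
(-w3 g8 `idelicCharacter_unitsMap_eq_one_of_inertia_le`). [cite: Washington1997, §13.1 Prop. 13.2] [cite: NeukirchANT1999, Ch. VI §5 Prop. (5.6)] -/
theorem idelicCharacter_unitsMap_eq_one_of_isUnramifiedOutside (κ : ZpExtension K p)
    {Λ : ideleGroup K →ₜ* Multiplicative ℤ_[p]}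
    (hΛ : ∀ (a : ideleGroup K) (γ : absoluteGaloisGroup K),
      absGaloisAbProj K γ = ideleArtinMap K a → Λ a = κ.toContinuousMonoidHom γ)
    {vbar : HeightOneSpectrum (𝓞 K)} (hκ : κ.IsUnramifiedOutside vbar)
    {u : HeightOneSpectrum (𝓞 K)} (hu : u ≠ vbar) (y : (u.adicCompletionIntegers K)ˣ) :
    Λ (localUnits u (Units.map ((u.adicCompletionIntegers K).subtype : _ →* _) y)) = 1 := by
  by_cases hpu : ((p : ℕ) : 𝓞 K) ∈ u.asIdeal
  · exact idelicCharacter_unitsMap_eq_one_of_inertia_le κ hΛ (hκ u hu) y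
  · exact idelicCharacter_localUnits_integer κ hΛ hpu y

/-! ## §2. The local rank at a degree-one prime: `n_{v̄} = 1` -/

omit [Fact p.Prime] in
/-- **`n_u ≥ 1` at `u ∣ p`**: if `p ∈ u` then `#(𝒪_u / p 𝒪_u) = p^n` forces `1 ≤ n` — `p` lies in the maximal ideal of `𝒪_u`, so
`p 𝒪_u ≠ 𝒪_u` and the quotient is not a singleton. [cite: NeukirchANT1999, Ch. II §5 Prop. (5.7)] -/
theorem one_le_of_natCard_quot_eq_pow {u : HeightOneSpectrum (𝓞 K)} (hu : ((p : ℕ) : 𝓞 K) ∈ u.asIdeal) {n : ℕ}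
    (hn : Nat.card (u.adicCompletionIntegers K ⧸ Ideal.span {(p : u.adicCompletionIntegers K)}) = p ^ n) :
    1 ≤ n := by
  by_contra h
  have hn0 : n = 0 := by omega
  rw [hn0, pow_zero] at hn
  -- the quotient is a singleton, so `p 𝒪_u = ⊤`, so `p` is a unit of `𝒪_u`
  haveI : Finite (u.adicCompletionIntegers K ⧸ Ideal.span {(p : u.adicCompletionIntegers K)}) :=
    Nat.finite_of_card_ne_zero (by rw [hn]; exact one_ne_zero)
  have hsub : Subsingleton (u.adicCompletionIntegers K ⧸ Ideal.span {(p : u.adicCompletionIntegers K)}) :=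
    (Nat.card_eq_one_iff_unique.mp hn).1
  have htop : Ideal.span {(p : u.adicCompletionIntegers K)} = ⊤ :=
    Ideal.Quotient.subsingleton_iff.mp hsub
  have hunit : IsUnit (p : u.adicCompletionIntegers K) :=
    (Ideal.span_singleton_eq_top).mp htop
  have h1 := (Valuation.Integers.isUnit_iff_valuation_eq_one (Valuation.valuationSubring.integers _)).1 hunit
  change Valued.v (((p : u.adicCompletionIntegers K) : u.adicCompletionIntegers K) : u.adicCompletion K) = 1 at h1
  have hp1 : Valued.v (((p : u.adicCompletionIntegers K) : u.adicCompletionIntegers K) : u.adicCompletion K) < 1 := by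
    rw [OneUnits.valued_natCast_adicCompletionIntegers]
    exact (u.intValuation_lt_one_iff_mem _).2 hu
  rw [h1] at hp1
  exact lt_irrefl _ hp1

/-- **At a split prime the local unit group has `ℤ_p`-rank one.** `K` a quadratic field (`[K:ℚ] = 2`), `v ≠ v̄` two places above `p`.
Then there are `N` and ONE continuous character `φ : 𝒪_{v̄}ˣ → ℤ_p` such that every continuous `ψ : 𝒪_{v̄}ˣ → ℤ_p` satisfies
`p^N ψ = c φ` for some `c ∈ ℤ_p`: `rank_{ℤ_p} U_{v̄} = [K_{v̄} : ℚ_p] = 1`. (From the tree's `n_u` characters at each `u ∣ p` with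
`Σ_{u∣p} n_u = [K:ℚ] = 2` and `n_v, n_{v̄} ≥ 1`.) [cite: Washington1997, §13.1 (proof of Thm. 13.4)] [cite: NeukirchANT1999, Ch. II §5 Prop. (5.7)] -/
theorem exists_localRank_one_of_split (hK2 : Module.finrank ℚ K = 2)
    {v vbar : HeightOneSpectrum (𝓞 K)} (hv : ((p : ℕ) : 𝓞 K) ∈ v.asIdeal) (hvbar : ((p : ℕ) : 𝓞 K) ∈ vbar.asIdeal)
    (hne : vbar ≠ v) :
    ∃ (N : ℕ) (φ : (vbar.adicCompletionIntegers K)ˣ →ₜ* Multiplicative ℤ_[p]),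
      ∀ ψ : (vbar.adicCompletionIntegers K)ˣ →ₜ* Multiplicative ℤ_[p], ∃ c : ℤ_[p],
        ∀ y : (vbar.adicCompletionIntegers K)ˣ, (p : ℤ_[p]) ^ N * (ψ y).toAdd = c * (φ y).toAdd := by
  classical
  have hp : p.Prime := Fact.out
  -- the places above `p`
  have hfin : {w : HeightOneSpectrum (𝓞 K) | (p : 𝓞 K) ∈ w.asIdeal}.Finite := by
    have hp0 : (Ideal.span {(p : 𝓞 K)} : Ideal (𝓞 K)) ≠ 0 := by
      rw [Ne, Ideal.zero_eq_bot, Ideal.span_singleton_eq_bot]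
      exact_mod_cast hp.ne_zero
    refine (Ideal.finite_factors hp0).subset fun w hw => ?_
    change w.asIdeal ∣ Ideal.span {(p : 𝓞 K)}
    rw [Ideal.dvd_span_singleton]
    exact hw
  let T : Finset (HeightOneSpectrum (𝓞 K)) := hfin.toFinset
  have hT : ∀ w : HeightOneSpectrum (𝓞 K), (p : 𝓞 K) ∈ w.asIdeal ↔ w ∈ T := fun w => by
    rw [Set.Finite.mem_toFinset]
    rfl
  -- local generators of the character groups of the `𝒪_wˣ`, `w ∣ p`
  have hloc : ∀ w : HeightOneSpectrum (𝓞 K), ∃ (n N : ℕ)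
      (φ : Fin n → ((w.adicCompletionIntegers K)ˣ →ₜ* Multiplicative ℤ_[p])),
      ((p : 𝓞 K) ∈ w.asIdeal →
        Nat.card (w.adicCompletionIntegers K ⧸ Ideal.span {(p : w.adicCompletionIntegers K)}) = p ^ n ∧
        ∀ ψ' : (w.adicCompletionIntegers K)ˣ →ₜ* Multiplicative ℤ_[p], ∃ c : Fin n → ℤ_[p],
          ∀ u : (w.adicCompletionIntegers K)ˣ,
            (p : ℤ_[p]) ^ N * (ψ' u).toAdd = ∑ i, c i * (φ i u).toAdd) := by
    intro w
    by_cases hw : (p : 𝓞 K) ∈ w.asIdeal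
    · obtain ⟨n, N, φ, hcard, -, hspan⟩ :=
        OneUnits.exists_continuousMonoidHom_adicCompletionIntegers_rank K w p hw
      exact ⟨n, N, φ, fun _ => ⟨hcard, hspan⟩⟩
    · exact ⟨0, 0, Fin.elim0, fun h => absurd h hw⟩
  choose n N φ hnφ using hloc
  have hsum : ∑ w ∈ T, n w = Module.finrank ℚ K :=
    OneUnits.sum_eq_finrank K p T (fun w hw => (hT w).1 hw) n fun w hw => (hnφ w ((hT w).2 hw)).1
  rw [hK2] at hsum
  -- `n_v, n_{v̄} ≥ 1` and `n_v + n_{v̄} ≤ Σ_{u ∣ p} n_u = 2`, so `n_{v̄} = 1`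
  have hv1 : 1 ≤ n v := one_le_of_natCard_quot_eq_pow hv (hnφ v hv).1
  have hvbar1 : 1 ≤ n vbar := one_le_of_natCard_quot_eq_pow hvbar (hnφ vbar hvbar).1
  have hle : n v + n vbar ≤ ∑ w ∈ T, n w := by
    have hsub : ({v, vbar} : Finset (HeightOneSpectrum (𝓞 K))) ⊆ T := by
      intro w hw
      rw [Finset.mem_insert, Finset.mem_singleton] at hw
      rcases hw with rfl | rfl
      · exact (hT _).1 hv
      · exact (hT _).1 hvbar
    have h2 : ∑ w ∈ ({v, vbar} : Finset (HeightOneSpectrum (𝓞 K))), n w = n v + n vbar :=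
      Finset.sum_pair hne.symm
    rw [← h2]
    exact Finset.sum_le_sum_of_subset hsub
  have hnvbar : n vbar = 1 := by omega
  -- read off the single character at `v̄`
  obtain ⟨hcard, hspan⟩ := hnφ vbar hvbar
  refine ⟨N vbar, φ vbar ⟨0, by rw [hnvbar]; exact Nat.one_pos⟩, fun ψ => ?_⟩
  obtain ⟨c, hc⟩ := hspan ψ
  refine ⟨c ⟨0, by rw [hnvbar]; exact Nat.one_pos⟩, fun y => ?_⟩
  rw [hc y]
  have huniv : (Finset.univ : Finset (Fin (n vbar))) = {⟨0, by rw [hnvbar]; exact Nat.one_pos⟩} := by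
    ext i
    simp only [Finset.mem_univ, Finset.mem_singleton, true_iff]
    ext
    have := i.2
    omega
  rw [huniv, Finset.sum_singleton]

/-! ## §3. Uniqueness of the `ℤ_p`-line unramified outside a split prime -/

omit [NumberField K] [Fact p.Prime] in
/-- Cross-multiplication in a domain: `q a = c φ`, `q b = c' φ`, `q ≠ 0` give `c' a - c b = 0`. [folklore] -/
theorem sub_eq_zero_of_mul_eq_mul_of_mul_eq_mul {R : Type} [CommRing R] [NoZeroDivisors R] {q a b φ c c' : R} (hq : q ≠ 0)
    (h1 : q * a = c * φ) (h2 : q * b = c' * φ) : c' * a - c * b = 0 := by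
  have h : q * (c' * a - c * b) = 0 := by
    calc q * (c' * a - c * b) = c' * (q * a) - c * (q * b) := by ring
      _ = 0 := by rw [h1, h2]; ring
  exact (mul_eq_zero.1 h).resolve_left hq

/-- **The idelic character of a line unramified outside `v̄` is NON-TRIVIAL on `𝒪_{v̄}ˣ`, with a NON-ZERO coordinate.** In the setting of
`exists_localRank_one_of_split`, for `κ` unramified outside `v̄` with idelic character `Λ` and `p^N Λ|_{𝒪_{v̄}ˣ} = c φ`: `c ≠ 0` — else
`Λ` kills all the local units above `p` (at `u ≠ v̄` by §1, at `v̄` because `ℤ_p` is torsion-free), against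
`exists_idelicCharacter_localUnits_ne_one` (`K_∞/K` is a non-trivial quotient of `Gal(M/K) ∼ U_p/Ē`). [cite: Lang1990, Ch. 5 §5, Thm. 5.1] -/
theorem coeff_ne_zero_of_isUnramifiedOutside [IsTotallyComplex K] (κ : ZpExtension K p)
    {Λ : ideleGroup K →ₜ* Multiplicative ℤ_[p]}
    (hΛ : ∀ (a : ideleGroup K) (γ : absoluteGaloisGroup K),
      absGaloisAbProj K γ = ideleArtinMap K a → Λ a = κ.toContinuousMonoidHom γ)
    {vbar : HeightOneSpectrum (𝓞 K)} (hκ : κ.IsUnramifiedOutside vbar) {N : ℕ}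
    {φ ψ : (vbar.adicCompletionIntegers K)ˣ →ₜ* Multiplicative ℤ_[p]}
    (hψ : ∀ y : (vbar.adicCompletionIntegers K)ˣ,
      ψ y = Λ (localUnits vbar (Units.map ((vbar.adicCompletionIntegers K).subtype : _ →* _) y)))
    {c : ℤ_[p]} (hc : ∀ y : (vbar.adicCompletionIntegers K)ˣ, (p : ℤ_[p]) ^ N * (ψ y).toAdd = c * (φ y).toAdd) :
    c ≠ 0 := by
  intro hc0
  have hp : p.Prime := Fact.out
  obtain ⟨w, hw, y, hne⟩ := exists_idelicCharacter_localUnits_ne_one κ hΛ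
  by_cases hwv : w = vbar
  · subst hwv
    apply hne
    have h := hc y
    rw [hc0, zero_mul, mul_eq_zero] at h
    have h' := h.resolve_left (pow_ne_zero _ (by exact_mod_cast hp.ne_zero))
    rw [← hψ y]
    exact Multiplicative.toAdd.injective (h'.trans toAdd_one.symm)
  · exact hne (idelicCharacter_unitsMap_eq_one_of_isUnramifiedOutside κ hΛ hκ hwv y)

/-- **Two `ℤ_p`-lines unramified outside a split prime `v̄` of an imaginary quadratic field are proportional**: `K` imaginary quadratic,
`v ≠ v̄` above `p`, `κ, κ'` unramified outside `v̄`; then `c' · κ = c · κ'` as maps `Γ_K → ℤ_p` for some NON-ZERO `c, c' ∈ ℤ_p`.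
Proof in the module docstring (idelic characters; local rank one at `v̄`; a character of `C_K` killing `∏_{u∣p} 𝒪_uˣ` is trivial).
[cite: Washington1997, §13.1 (proof of Thm. 13.4)] [cite: Lang1990, Ch. 5 §5, Thm. 5.2] -/
theorem exists_mul_eq_mul_of_isUnramifiedOutside (hK : IsImaginaryQuadratic K)
    {v vbar : HeightOneSpectrum (𝓞 K)} (hv : ((p : ℕ) : 𝓞 K) ∈ v.asIdeal) (hvbar : ((p : ℕ) : 𝓞 K) ∈ vbar.asIdeal)
    (hne : vbar ≠ v) (κ κ' : ZpExtension K p) (hκ : κ.IsUnramifiedOutside vbar) (hκ' : κ'.IsUnramifiedOutside vbar) :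
    ∃ c c' : ℤ_[p], c ≠ 0 ∧ c' ≠ 0 ∧
      ∀ γ : absoluteGaloisGroup K, c' * (κ γ).toAdd = c * (κ' γ).toAdd := by
  classical
  have hp : p.Prime := Fact.out
  haveI : IsTotallyComplex K := hK.2
  obtain ⟨Λ, hΛ⟩ := exists_idelicCharacter κ.toContinuousMonoidHom
  obtain ⟨Λ', hΛ'⟩ := exists_idelicCharacter κ'.toContinuousMonoidHom
  obtain ⟨N, φ, hφ⟩ := exists_localRank_one_of_split (p := p) hK.1 hv hvbar hne
  -- restrictions to `𝒪_{v̄}ˣ` and their coordinates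
  let res : (ideleGroup K →ₜ* Multiplicative ℤ_[p]) → ((vbar.adicCompletionIntegers K)ˣ →ₜ* Multiplicative ℤ_[p]) :=
    fun L => ⟨L.toMonoidHom.comp ((localUnits vbar).comp (Units.map ((vbar.adicCompletionIntegers K).subtype :
        vbar.adicCompletionIntegers K →* vbar.adicCompletion K))),
      L.continuous.comp (IdelicCharacter.continuous_localUnits_unitsMap vbar)⟩
  have hres : ∀ L (y : (vbar.adicCompletionIntegers K)ˣ), res L y =
      L (localUnits vbar (Units.map ((vbar.adicCompletionIntegers K).subtype : _ →* _) y)) := fun L y => rfl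
  obtain ⟨c, hc⟩ := hφ (res Λ)
  obtain ⟨c', hc'⟩ := hφ (res Λ')
  have hc0 : c ≠ 0 := coeff_ne_zero_of_isUnramifiedOutside κ hΛ hκ (hres Λ) hc
  have hc'0 : c' ≠ 0 := coeff_ne_zero_of_isUnramifiedOutside κ' hΛ' hκ' (hres Λ') hc'
  -- the idelic character `G = c' Λ - c Λ'`
  let G : ideleGroup K →ₜ* Multiplicative ℤ_[p] :=
    { toFun := fun x => Multiplicative.ofAdd (c' * (Λ x).toAdd - c * (Λ' x).toAdd)
      map_one' := by simp
      map_mul' := fun x y => by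
        rw [← ofAdd_add]
        congr 1
        have h1 : (Λ (x * y)).toAdd = (Λ x).toAdd + (Λ y).toAdd := by rw [map_mul, toAdd_mul]
        have h2 : (Λ' (x * y)).toAdd = (Λ' x).toAdd + (Λ' y).toAdd := by rw [map_mul, toAdd_mul]
        rw [h1, h2]
        ring
      continuous_toFun := continuous_ofAdd.comp
        ((continuous_const.mul (continuous_toAdd.comp Λ.continuous)).sub
          (continuous_const.mul (continuous_toAdd.comp Λ'.continuous))) }
  have hG : ∀ x, (G x).toAdd = c' * (Λ x).toAdd - c * (Λ' x).toAdd := fun x => rfl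
  have hGprinc : ∀ x ∈ principalIdeles K, G x = 1 := fun x hx => by
    apply Multiplicative.toAdd.injective
    rw [hG, toAdd_one, idelicCharacter_eq_one_of_mem_principalIdeles hΛ hx,
      idelicCharacter_eq_one_of_mem_principalIdeles hΛ' hx, toAdd_one, mul_zero, mul_zero, sub_self]
  have hGloc : ∀ w : HeightOneSpectrum (𝓞 K), (p : 𝓞 K) ∈ w.asIdeal →
      ∀ y : (w.adicCompletionIntegers K)ˣ,
        G (localUnits w (Units.map ((w.adicCompletionIntegers K).subtype : _ →* _) y)) = 1 := by
    intro w hw y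
    apply Multiplicative.toAdd.injective
    rw [hG, toAdd_one]
    by_cases hwv : w = vbar
    · subst hwv
      -- multiply by `p^N`: `p^N (c' Λ - c Λ') = c' c φ - c c' φ = 0`
      have hpN : (p : ℤ_[p]) ^ N ≠ 0 := pow_ne_zero _ (by exact_mod_cast hp.ne_zero)
      rw [← hres Λ, ← hres Λ']
      exact sub_eq_zero_of_mul_eq_mul_of_mul_eq_mul hpN (hc y) (hc' y)
    · rw [idelicCharacter_unitsMap_eq_one_of_isUnramifiedOutside κ hΛ hκ hwv y,
        idelicCharacter_unitsMap_eq_one_of_isUnramifiedOutside κ' hΛ' hκ' hwv y, toAdd_one, mul_zero, mul_zero, sub_self]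
  have hG1 : G = 1 := IdelicCharacter.eq_one_of_forall_localUnits (p := p) G hGprinc hGloc
  refine ⟨c, c', hc0, hc'0, fun γ => ?_⟩
  obtain ⟨a, ha⟩ := exists_ideleArtinMap_eq (K := K) γ
  have h := congrArg Multiplicative.toAdd (DFunLike.congr_fun hG1 a)
  rw [hG, hΛ a γ ha.symm, hΛ' a γ ha.symm] at h
  change c' * (κ γ).toAdd - c * (κ' γ).toAdd = (1 : Multiplicative ℤ_[p]).toAdd at h
  rw [toAdd_one, sub_eq_zero] at h
  exact h

/-- **UNIQUENESS OF THE `ℤ_p`-LINE UNRAMIFIED OUTSIDE A SPLIT PRIME (the uniqueness conjunct of the named fact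
`ZpExtension.existsUnique_isUnramifiedOutside_of_split`, PROVED).** `K` imaginary quadratic, `v ≠ v̄` two places above the prime `p`,
`κ, κ'` two `ℤ_p`-extensions of `K` unramified outside `v̄`. Then `ker κ' = ker κ`: both cut out THE SAME field `K_∞` («the unique
`ℤ_p`-extension of `K` unramified outside `𝔭`»; as maps they differ by a unit, `ZpExtension.exists_eq_unitTwist_of_kerSubgroup_eq`).
From `exists_mul_eq_mul_of_isUnramifiedOutside` (`c' κ = c κ'`, `c c' ≠ 0`, `ℤ_p` a domain).
[cite: Agboola2007, §1 p. 1 (arXiv p0003:L3–11)] [cite: deShalit1987, II.4.17] [cite: Washington1997, §13.1 Thm. 13.4] -/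
theorem kerSubgroup_eq_of_isUnramifiedOutside (hK : IsImaginaryQuadratic K)
    {v vbar : HeightOneSpectrum (𝓞 K)} (hv : ((p : ℕ) : 𝓞 K) ∈ v.asIdeal) (hvbar : ((p : ℕ) : 𝓞 K) ∈ vbar.asIdeal)
    (hne : vbar ≠ v) (κ κ' : ZpExtension K p) (hκ : κ.IsUnramifiedOutside vbar) (hκ' : κ'.IsUnramifiedOutside vbar) :
    κ'.kerSubgroup = κ.kerSubgroup := by
  obtain ⟨c, c', hc0, hc'0, hrel⟩ := exists_mul_eq_mul_of_isUnramifiedOutside hK hv hvbar hne κ κ' hκ hκ'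
  ext γ
  rw [mem_kerSubgroup, mem_kerSubgroup]
  have h := hrel γ
  constructor
  · intro h1
    rw [h1, toAdd_one, mul_zero, mul_eq_zero] at h
    exact Multiplicative.toAdd.injective ((h.resolve_left hc'0).trans toAdd_one.symm)
  · intro h1
    rw [h1, toAdd_one, mul_zero] at h
    have h2 := (mul_eq_zero.1 h.symm).resolve_left hc0
    exact Multiplicative.toAdd.injective (h2.trans toAdd_one.symm)

/-- The same with the roles of `v, v̄` exchanged: two `ℤ_p`-extensions unramified outside `v` have the same kernel (`K_∞` is unique).
[cite: Agboola2007, §1 p. 1 (arXiv p0003:L9–11)] -/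
theorem kerSubgroup_eq_of_isUnramifiedOutside' (hK : IsImaginaryQuadratic K)
    {v vbar : HeightOneSpectrum (𝓞 K)} (hv : ((p : ℕ) : 𝓞 K) ∈ v.asIdeal) (hvbar : ((p : ℕ) : 𝓞 K) ∈ vbar.asIdeal)
    (hne : vbar ≠ v) (κ κ' : ZpExtension K p) (hκ : κ.IsUnramifiedOutside v) (hκ' : κ'.IsUnramifiedOutside v) :
    κ'.kerSubgroup = κ.kerSubgroup :=
  kerSubgroup_eq_of_isUnramifiedOutside hK hvbar hv hne.symm κ κ' hκ hκ'

end Summit.BirchSwinnertonDyer.BirchSwinnertonDyer.Theorems.PrintCf2.LineDecomposition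

end
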